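import Summits.BirchSwinnertonDyer.Rank1Residual.X11b.BDPFrameUniquenessInt
import HarnessLib

/-!
# X11b — rigidity of a HSIEH witness at fixed data (every `p`): two `Q ∈ 𝓞_{ℂ_p}⟦T⟧` with the same
# Hsieh interpolation data `IsHsiehLFunction ι 𝔭 κ γ f A Ω_K C Ω_p ·` coincide, given a supply of
# interpolation characters accumulating at `𝟙` (cell `b2b-bsdres`, sub-cell `multr1-p2`, gen 24)

HONEST FRAMING (cell `b2b-bsdres`, run/shared/lean/b2b/bsd-rank1-residual/, verbatim in every
file): the goal of the cell is to DELETE the COMBINATION-SHAPED residual classes of the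
Birch–Swinnerton-Dyer formula for ALL analytic-rank `≤ 1` elliptic curves over `ℚ` — "full BSD
formula for every rank `≤ 1` curve in class `C`" assembled STRICTLY from published theorems — so
that the rank-`≤ 1` remainder becomes exactly the CONSTRUCTION-SHAPED classes, which are TYPED
(missing-input `Prop`s), NOT attempted. This is not "finishing BSD". Sub-cell `multr1-p2` is a
RESEARCH ROUTE on class X11b; no claim beyond the stated class and loci; X11b's label does not
change; NOTHING is booked by this file.

THEOREMS ONLY (no definition, no named fact, no `sorry`); valid at every prime `p`. The rigidity of
an element of `𝓞_{ℂ_p}⟦T⟧` along a null sequence is multr1-p1's `R1.intSeries_eq_of_hasValueAt`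
(`BDPFrameUniquenessInt.lean`, from gen 22's identity principle), IMPORTED — not restated.

## Why (gen 24, companion of `BDPRouteHsiehFrame.lean`)

`BDPRouteHsiehFrame.lean` realises conjunct 3.1♭ of route p2's open input H∃♭ on every pair by a
HSIEH witness (lit1's published fact `hsieh2014_exists_anticyclotomicPAdicLFunction`, whose conclusion
is `∃ (A, Ω_K, C, Ω_p, Q), … ∧ IsHsiehLFunction ι 𝔭 κ γ f A Ω_K C Ω_p Q`), and
`P2.imcDivIntFrameOnTree_of_hsiehFrame` lets H∃♭ be supplied as a value / divisibility statement about
"Hsieh's `Q`". multr1-p1's `BDPFrameUniquenessInt.lean` settles, at FIXED periods, that Castella's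
♭-display `R1.IsBDPLFunctionInt` pins `Q`; this file records the same for HSIEH's display:

* **`isHsiehLFunction_unique_of_tendsto`** — two witnesses `Q, Q'` of
  `IsHsiehLFunction ι 𝔭 κ γ f A Ω_K C Ω_p ·` (the SAME `(A, Ω_K, C, Ω_p)`) are EQUAL, given a SUPPLY of
  interpolation data `(φ_k, n_k, r_k)` (`φ_k` unramified of infinity type `(n_k, −n_k)`, `n_k > 0`,
  `r_k` its avatar through `κ`) with `φ̂_k(γ) → 1`, `φ̂_k(γ) ≠ 1` infinitely often (a hypothesis; in
  nature the powers of the auxiliary `λ` of the λ-supply);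
* `isHsiehLFunction_forall_of_exists_of_tendsto` — at fixed Hsieh data, "some witness has `P`" =
  "every witness has `P`": the `∃ Q` of the named fact speaks about ONE element, and a statement about
  "Hsieh's `𝒫_Σ(π,λ)²`" at those data is a statement about it.

WHAT THIS DOES NOT DO: witnesses with different `(A, Ω_K, C, Ω_p)` are not compared (they differ by
the re-normalisations of `Three/HsiehDisplayGlue.lean` / `BDPRouteHsiehFrame.lean` §1 and, across
periods, by the factor handled in x11b3-p3's `BDPValueRigidity.lean` for the value at `𝟙`). No label
change; nothing booked.

References: [Hsieh2014] M.-L. Hsieh, Doc. Math. 19 (2014), Thm. 1 (arXiv:1112.1580 pp. 3–4);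
[Cassels1986] Ch. 4 Thm. 4.1 (Strassmann; bounded variant via isolated zeros).
-/

noncomputable section

open scoped Classical Topology

open Filter PowerSeries NumberField IsDedekindDomain
open Literature.NumberTheory.EllipticCurves Literature.NumberTheory.EllipticCurves.ModularForms
open Literature.NumberTheory.GaloisRepresentations

namespace Summit.BirchSwinnertonDyer.Rank1Residual.X11b

variable {p : ℕ} [Fact p.Prime] {K : Type} [Field K] [NumberField K] {N : ℕ}
  {ι : PadicAlgCl p ≃+* ℂ} {𝔭 : HeightOneSpectrum (𝓞 K)} {κ : ZpExtension K p}
  {γ : Field.absoluteGaloisGroup K} {f : CuspForm (CongruenceSubgroup.Gamma0 N) 2} {A : ℝ}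
  {ΩK C : ℂ} {Ωp : ℂ_[p]}

/-- **Rigidity of Hsieh's witness at fixed data.** Two elements `Q, Q' ∈ 𝓞_{ℂ_p}⟦T⟧` with
`IsHsiehLFunction ι 𝔭 κ γ f A Ω_K C Ω_p Q` and `… Q'` (Hsieh 2014 Thm. 1's display, the SAME
`(A, Ω_K, C, Ω_p)`) are EQUAL, provided a SUPPLY of interpolation data `(φ_k, n_k, r_k)` (`φ_k`
unramified of infinity type `(n_k, −n_k)`, `n_k > 0`, `r_k` its `p`-adic avatar through `κ`) with
`φ̂_k(γ) → 1` in `ℂ_p` and `φ̂_k(γ) ≠ 1` infinitely often: both take the prescribed value at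
`T = φ̂_k(γ) − 1 → 0` (`IsHsiehLFunction.hasValueAt`), and multr1-p1's `R1.intSeries_eq_of_hasValueAt`
applies. Witnesses with different data are NOT compared. [cite: Hsieh2014, Thm. 1 (arXiv:1112.1580 pp. 3–4)] -/
theorem isHsiehLFunction_unique_of_tendsto {Q Q' : PowerSeries 𝓞_ℂ_[p]}
    (hQ : IsHsiehLFunction ι 𝔭 κ γ f A ΩK C Ωp Q) (hQ' : IsHsiehLFunction ι 𝔭 κ γ f A ΩK C Ωp Q')
    {φ : ℕ → HeckeCharacter K} {n : ℕ → ℕ} {r : ℕ → FramedGaloisRep K (PadicAlgCl p) 1}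
    (hn : ∀ k, 0 < n k) (hunr : ∀ k (v : HeightOneSpectrum (𝓞 K)), (φ k).IsUnramifiedAt v)
    (hinf : ∀ k, (φ k).HasInfinityType (fun _ ↦ (n k : ℤ)) (fun _ ↦ -(n k : ℤ)))
    (hr : ∀ k, IsPAdicAvatarOf ι (φ k) (r k)) (hκ : ∀ k, FactorsThroughZp κ (r k))
    (hlim : Tendsto (fun k ↦ avatarValueAt (r k) γ) atTop (𝓝 1))
    (hne : ∃ᶠ k in atTop, avatarValueAt (r k) γ ≠ 1) : Q = Q' := by
  refine R1.intSeries_eq_of_hasValueAt (x := fun k ↦ avatarValueAt (r k) γ - 1)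
    (v := fun k ↦ ((ι.symm (hsiehInterpolationValue p f 𝔭 (φ k) (n k) A ΩK C) : PadicAlgCl p) :
      ℂ_[p]) * Ωp ^ (4 * n k)) ?_ ?_
    (fun k ↦ hQ.hasValueAt (hn k) (hunr k) (hinf k) (hr k) (hκ k))
    (fun k ↦ hQ'.hasValueAt (hn k) (hunr k) (hinf k) (hr k) (hκ k))
  · rw [← sub_self (1 : ℂ_[p])]
    exact hlim.sub_const 1
  · exact hne.mono fun k hk ↦ sub_ne_zero.mpr hk

/-- **At fixed Hsieh data, "some witness" = "every witness".** Under the supply hypothesis, a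
property `P` of SOME `Q` with `IsHsiehLFunction ι 𝔭 κ γ f A Ω_K C Ω_p Q` holds of EVERY such `Q'` —
the exact sense in which a value / divisibility statement about "Hsieh's element" at fixed data (the
hypothesis of `P2.imcDivIntFrameOnTree_of_hsiehFrame`) is a statement about one element.
[cite: Hsieh2014, Thm. 1 (arXiv:1112.1580 pp. 3–4)] -/
theorem isHsiehLFunction_forall_of_exists_of_tendsto {P : PowerSeries 𝓞_ℂ_[p] → Prop}
    {φ : ℕ → HeckeCharacter K} {n : ℕ → ℕ} {r : ℕ → FramedGaloisRep K (PadicAlgCl p) 1}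
    (hn : ∀ k, 0 < n k) (hunr : ∀ k (v : HeightOneSpectrum (𝓞 K)), (φ k).IsUnramifiedAt v)
    (hinf : ∀ k, (φ k).HasInfinityType (fun _ ↦ (n k : ℤ)) (fun _ ↦ -(n k : ℤ)))
    (hr : ∀ k, IsPAdicAvatarOf ι (φ k) (r k)) (hκ : ∀ k, FactorsThroughZp κ (r k))
    (hlim : Tendsto (fun k ↦ avatarValueAt (r k) γ) atTop (𝓝 1))
    (hne : ∃ᶠ k in atTop, avatarValueAt (r k) γ ≠ 1)
    (hex : ∃ Q, IsHsiehLFunction ι 𝔭 κ γ f A ΩK C Ωp Q ∧ P Q) {Q' : PowerSeries 𝓞_ℂ_[p]}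
    (hQ' : IsHsiehLFunction ι 𝔭 κ γ f A ΩK C Ωp Q') : P Q' := by
  obtain ⟨Q, hQ, hP⟩ := hex
  rwa [isHsiehLFunction_unique_of_tendsto hQ hQ' hn hunr hinf hr hκ hlim hne] at hP

end Summit.BirchSwinnertonDyer.Rank1Residual.X11b

end
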